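import Summits.Ventures.HodgeRepro0.P6AokiQuotientLevel180FactsA
import Summits.Ventures.HodgeRepro0.P6AokiQuotientLevel180FactsC0
import Summits.Ventures.HodgeRepro0.P6AokiQuotientLevel180FactsC1
import Summits.Ventures.HodgeRepro0.P6AokiQuotientLevel180FactsC2
import Summits.Ventures.HodgeRepro0.P6AokiQuotientLevel180FactsC3
import Summits.Ventures.HodgeRepro0.P6AokiQuotientLevel180FactsB0
import Summits.Ventures.HodgeRepro0.P6AokiQuotientLevel180FactsB1
import Summits.Ventures.HodgeRepro0.P6AokiQuotientLevel180FactsB2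
import Summits.Ventures.HodgeRepro0.P6AokiQuotientLevel180FactsB3
import Summits.Ventures.HodgeRepro0.P6AokiQuotientLevel180FactsB4
import Summits.Ventures.HodgeRepro0.P6AokiQuotientLevel180FactsB5
import Summits.Ventures.HodgeRepro0.P6AokiQuotientLevel180FactsB6
import Summits.Ventures.HodgeRepro0.P6AokiQuotientLevel180FactsB7

/-!
# Aoki's quotient `B_q/(S_q + D_q)` at the level q = 180 — kernel certificate (part 18 of 18)

`hℓ` assembled from its 4 row ranges and `hℓexpr` from its 8 row ranges (the statement byte-identical to the one-file version), the facts `h2β` / `hσβ`, and the theorem `main` (`L180.main`) by `level_of_decided`.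
-/

namespace HodgeRepro0.P6AokiQuotient

namespace L180
/-- level 180: the kernel-decided fact `hℓ` of `level_of_decided`. -/
theorem fact_hell : ∀ i < 155, ∀ j < 155, (ellL.getD i []).getD (pivL.getD j 0) 0 = if i = j then 1 else 0 := by
  intro i hi
  by_cases h0 : i < 39
  · exact fact_hell_0 i h0
  by_cases h1 : i < 78
  · have := fact_hell_1 (i - 39) (by omega)
    rwa [show 39 + (i - 39) = i by omega] at this
  by_cases h2 : i < 116
  · have := fact_hell_2 (i - 78) (by omega)
    rwa [show 78 + (i - 78) = i by omega] at this
  · have := fact_hell_3 (i - 116) (by omega)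
    rwa [show 116 + (i - 116) = i by omega] at this
/-- level 180: the kernel-decided fact `hℓexpr` of `level_of_decided`. -/
theorem fact_hellexpr : ∀ i < 155, ellL.getD i [] = lincombList (180 - 1) (List.zip (exprG.getD i []) (exprC.getD i [])) (genDenseL ++ betaL) := by
  intro i hi
  by_cases h0 : i < 19
  · exact fact_hellexpr_0 i h0
  by_cases h1 : i < 39
  · have := fact_hellexpr_1 (i - 19) (by omega)
    rwa [show 19 + (i - 19) = i by omega] at this
  by_cases h2 : i < 58
  · have := fact_hellexpr_2 (i - 39) (by omega)
    rwa [show 39 + (i - 39) = i by omega] at this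
  by_cases h3 : i < 78
  · have := fact_hellexpr_3 (i - 58) (by omega)
    rwa [show 58 + (i - 58) = i by omega] at this
  by_cases h4 : i < 97
  · have := fact_hellexpr_4 (i - 78) (by omega)
    rwa [show 78 + (i - 78) = i by omega] at this
  by_cases h5 : i < 116
  · have := fact_hellexpr_5 (i - 97) (by omega)
    rwa [show 97 + (i - 97) = i by omega] at this
  by_cases h6 : i < 136
  · have := fact_hellexpr_6 (i - 116) (by omega)
    rwa [show 116 + (i - 116) = i by omega] at this
  · have := fact_hellexpr_7 (i - 136) (by omega)
    rwa [show 136 + (i - 136) = i by omega] at this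
/-- level 180: the kernel-decided fact `h2β` of `level_of_decided`. -/
theorem fact_h2beta : ∀ j < 3, smulL 2 (betaL.getD j []) = lincombList (180 - 1) (List.zip (twoBG.getD j []) (twoBC.getD j [])) genDenseL := by decide +kernel
/-- level 180: the kernel-decided fact `hσβ` of `level_of_decided`. -/
theorem fact_hsigmabeta : ∀ s < gensL.length, ∀ j < 3, vsubL (sigmaList 180 (gensL.getD s 0) (betaL.getD j [])) (betaL.getD j []) = lincombList (180 - 1) (List.zip ((sigG.getD s []).getD j []) ((sigC.getD s []).getD j [])) genDenseL := by decide +kernel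
/-- THE STRUCTURE OF AOKI'S QUOTIENT AT LEVEL 180: `S_180 + D_180 ⊆ B_180`; `B_180 = (S_180 + D_180) + ⟨β_1, …, β_3⟩`; a combination `Σ c_j β_j` lies in `S_180 + D_180` iff every `c_j` is even (so `B_180/(S_180 + D_180) ≅ (ℤ/2)^3`); and `σ_t v − v ∈ S_180 + D_180` for every `v ∈ B_180` and every unit `t` (the group `(ℤ/180)^×` acts trivially on the quotient). -/
theorem main : SD 180 ≤ B 180 ∧
    B 180 = SD 180 ⊔ Submodule.span ℤ (Set.range (fun j : Fin 3 => toV 179 (betaL.getD j []))) ∧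
    (∀ c : Fin 3 → ℤ, (∑ j, c j • toV 179 (betaL.getD j [])) ∈ SD 180 ↔ ∀ j, 2 ∣ c j) ∧
    (∀ v ∈ B 180, ∀ t ∈ unitsList 180, sigmaL 180 t v - v ∈ SD 180) :=
  level_of_decided 180 155 24 3 genDenseL genDense_eq ellL pivL PL YL 10800 betaL FL exprG exprC twoBG twoBC gensL wordsL sigG sigC (by decide)
    fact_hbound fact_htheta fact_hpiv fact_hP fact_hell fact_hY fact_hcover fact_hPinj fact_hbetalen fact_hellexpr fact_hbetaB fact_hpar fact_hparbeta fact_h2beta fact_hgu fact_hwords fact_F1 fact_F2 fact_F3 fact_F4 fact_hsigmabeta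
end L180

end HodgeRepro0.P6AokiQuotient
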